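import Literature.NumberTheory.LFunctions.DirichletExplicitRegionRealZeros
import Literature.NumberTheory.LFunctions.DirichletXiHadamardProduct
import Literature.NumberTheory.LFunctions.FordZetaZeroRecipSqSum
import HarnessLib

/-!
# McCurley's explicit region for Dirichlet `L`-functions: the analytic lemmas at COMPLEX points

Topic `Literature/NumberTheory/LFunctions` (namespace `Literature.NumberTheory.LFunctions`;
sub-namespaces `McCurleyStechkin` and `DirichletTheta`, continuing
`ExplicitLandauRepulsionStechkin.lean` (real points, two real characters) and
`DirichletExplicitRegionRealZeros.lean` (real points, all characters)). Everything here is PROVED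
(standard axioms); the `def`s (`stF`, `fAt`, `fAtZeta`, `gammaDiff`, `zerosRefl`)
are definitions with bodies; NO named fact is introduced.

Source: K. S. McCurley, *Explicit zero-free regions for Dirichlet L-functions*, J. Number Theory
**19** (1984) 7–32 [McCurley1984ZFR], §2–§3. McCurley's proof of Theorem 1 for a zero
`ρ = β + iγ`, `γ ≠ 0`, evaluates `f(t, χ) := Re(−L'/L(σ + it, χ)) − κ Re(−L'/L(σ₁ + it, χ))`
(`κ = 1/√5`, `σ₁ = (1 + √(1 + 4σ²))/2`, §2 (5)) at the COMPLEX points `σ + imγ`, `0 ≤ m ≤ 4`, and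
combines (§4 (27)) `Σₘ aₘ f(mγ, χᵐ) ≥ 0` with the upper bounds of Lemmas 5–7. This file proves the
zero-sum side of those lemmas at complex points — everything in §3 except the Gamma-factor
numerics of Lemmas 1–2 (the tables `d(a,m)`, `c(a,m)`) and the prime sums of Lemma 3, which are left
symbolic (`gammaDiff`, the digamma terms, `uCorr`):

* **Lemma 4 (Stechkin) at complex points** (`stechkin_stF`, `inv_sub_le_stF`): with
  `F(s, z) = Re[1/(s − z) + 1/(s − 1 + z̄)]`, `s = σ + it`, `s₁ = σ₁ + it`, `σ ≥ 1`:
  `F(s, z) − κ F(s₁, z) ≥ 0` for `0 < Re z < 1`, and `≥ 1/(σ − Re z)` when moreover `t = Im z`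
  (McCurley states the second clause for `½ ≤ Re z`; the tree's `inv_sub_le_stechkinPair` gives it
  for `0 < Re z ≤ 1`).
* **(13) for a primitive character, Stechkin-differenced** (`DirichletTheta.hasSum_stechkinDiff`):
  `f(t, χ) = K log q + [Re Γℝ'/Γℝ(s + a) − κ Re Γℝ'/Γℝ(s₁ + a)] − Σ_ρ [Re 1/(s − ρ) − κ Re 1/(s₁ − ρ)]`
  over the zeros of `ξ(·, χ)` with multiplicity (`K = (1 − κ)/2`; from MV Cor. 10.18 for ONE
  character, the tree's `hasSum_re_inv_sub_zeros`), the pairing `ρ ↔ 1 − ρ̄` of the zero multiset as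
  a permutation of the index type (`zerosRefl`), hence (`sum_pairs_le`) every finite set of PAIRS is
  dominated: `Σ_{ρ ∈ S} ½[F(s,ρ) − κF(s₁,ρ)] ≤ K log q + Γ-terms − f(t, χ)`.
* **Lemma 6, primitive case, and Lemma 5 / (14)** (`fAt_le`, `fAt_le_of_zero`, `fAt_le_of_zero_im`):
  `f(t, χ) ≤ K log q + Γ-terms`, and with a zero `ρ = β + iγ` of `L(s, χ)` (`β > 0`, `β ≠ ½`) kept,
  `f(t, χ) ≤ K log q + Γ-terms − [F(s,ρ) − κF(s₁,ρ)]`, `f(γ, χ) ≤ K log q + Γ-terms − 1/(σ − β)`.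
* **Lemma 6, induced case, (15)–(16)** (`re_negLogDeriv_changeLevel_complex`, `fAt_changeLevel_eq`,
  `fAt_induced_le`, `fAt_induced_le_of_zero_im`): for `χ` mod `k` induced by `χ₁` mod `d`,
  `f(t, χ) = f(t, χ₁) − Σ_{p∣k} [Re e − κ Re e₁]` with the complex Euler corrections
  `e = e(χ₁(p)p^{−it}, p, σ)` of `DirichletExplicitRegionRealZeros.lean`, `|e| ≤ log p · u/(1−u)`; so
  `f(t, χ) ≤ K log k + Γ-terms + Σ_{p∣k} max(G(p,σ), 0)` (`G` = `gPen`, McCurley's `T(k, k₁)`).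
* **Lemma 7 core, (18)–(19)** (`hasSum_zeta_stechkinDiff`, `fAtZeta_le`, `fAt_one_eq`,
  `fAt_one_le`): `f_ζ(t) ≤ [Re 1/(s−1) − κ Re 1/(s₁−1)] − K log π + ½[Re ψ(s/2+1) − κ Re ψ(s₁/2+1)]`
  (de la Vallée Poussin's formula with multiplicities, the tree's `re_neg_logDeriv_zeta_hadamard`,
  and the pairing `ρ ↔ 1 − ρ̄` of the zeta zeros, `riemannZetaZeroOrder_one_sub_conj`), and
  `f(t, χ₀ mod k) = f_ζ(t) − Σ_{p∣k}[Re e(p^{−it},p,σ) − κ Re e(p^{−it},p,σ₁)] ≤ f_ζ(t) + Σ_{p∣k}(U + κU₁)`.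
* **(27) at complex points** (`rosser_positivity_complex`): for every `χ` mod `k`, `σ > 1`, real `t`:
  `0 ≤ a₀ f_{χ₀}(σ) + a₁ f(t, χ) + a₂ f(2t, χ²) + a₃ f(3t, χ³) + a₄ f(4t, χ⁴)` — the combined
  Dirichlet series is `Σₙ Λ(n)(n^{−σ} − κn^{−σ₁}) P(arg(χ(n)n^{−it})) ≥ 0`
  (`hasSum_re_twist_complex`: `Re(−L'/L(σ+it, χ)) = Σ Λ(n) n^{−σ} Re(χ(n) n^{−it})`).

At `t = 0` these specialise to the real-point statements of the two earlier files (`fAt_zero`,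
`fAtZeta_zero`). What remains for Theorem 1 at complex zeros is McCurley's Lemmas 1–3 (numerics) and
the casework of §4–§6.

## References

* K. S. McCurley, J. Number Theory 19 (1984) 7–32, doi:10.1016/0022-314x(84)90089-1: §2 (5),
  Lemma 4 (p. 15), (13)–(14) and Lemmas 5–6 (pp. 15–17), Lemma 7 (17)–(19) (pp. 17–18), §4 (27)
  (p. 22). [McCurley1984ZFR]
* S. B. Stechkin, Mat. Zametki 8 (1970) 419–429 (Lemma 4). [Stechkin1970]
* H. L. Montgomery, R. C. Vaughan, *Multiplicative Number Theory I*, Cor. 10.18 (10.36)–(10.38),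
  Thm. 14.5 (proof), (4.25). [MontgomeryVaughan2007]
* H. Kadiri, *Une région explicite sans zéros pour la fonction ζ de Riemann*, Acta Arith. 117 (2005),
  (1.1) (the `ζ` formula with multiplicities). [Kadiri2005]
-/

noncomputable section

open Real Complex
open scoped ComplexConjugate

namespace Literature.NumberTheory.LFunctions

namespace McCurleyStechkin

/-! ## Lemma 4 (Stechkin) at complex points -/

section Stechkin

/-- McCurley's `F(s, z) = Re[1/(s − z) + 1/(s − 1 + z̄)]` — the Hadamard terms, seen from `s`, of the
pair of zeros `z`, `1 − z̄` of `ξ(·, χ)`. [cite: McCurley1984ZFR, Lemma 4] -/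
def stF (s z : ℂ) : ℝ := ((s - z)⁻¹).re + ((s - (1 - conj z))⁻¹).re

/-- `Re 1/(σ + it − z) = (σ − Re z)/((σ − Re z)² + (t − Im z)²)` (the first term of McCurley's `F(s, z)`
in coordinates). [cite: McCurley1984ZFR, Lemma 4] -/
theorem re_inv_sub_eq (σ t : ℝ) (z : ℂ) :
    (((σ : ℂ) + t * I - z)⁻¹).re = (σ - z.re) / ((σ - z.re) ^ 2 + (t - z.im) ^ 2) := by
  rw [Complex.inv_re, Complex.normSq_apply]
  simp only [sub_re, add_re, ofReal_re, mul_re, I_re, mul_zero, ofReal_im, I_im, mul_one,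
    sub_self, add_zero, sub_im, add_im, mul_im, zero_add]
  ring

/-- `Re 1/(σ + it − (1 − z̄)) = (σ − 1 + Re z)/((σ − 1 + Re z)² + (t − Im z)²)` (the second term of
McCurley's `F(s, z)` in coordinates). [cite: McCurley1984ZFR, Lemma 4] -/
theorem re_inv_sub_one_sub_conj_eq (σ t : ℝ) (z : ℂ) :
    (((σ : ℂ) + t * I - (1 - conj z))⁻¹).re =
      (σ - 1 + z.re) / ((σ - 1 + z.re) ^ 2 + (t - z.im) ^ 2) := by
  rw [Complex.inv_re, Complex.normSq_apply]
  simp only [sub_re, add_re, ofReal_re, mul_re, I_re, mul_zero, ofReal_im, I_im, mul_one,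
    sub_self, add_zero, one_re, conj_re, sub_im, add_im, mul_im, zero_add, one_im, conj_im,
    sub_neg_eq_add]
  ring

/-- `F(σ + it, z)` in coordinates `z = β + iγ`:
`(σ−β)/((σ−β)² + (t−γ)²) + (σ−1+β)/((σ−1+β)² + (t−γ)²)`. [cite: McCurley1984ZFR, Lemma 4] -/
theorem stF_eq (σ t : ℝ) (z : ℂ) :
    stF (σ + t * I) z = (σ - z.re) / ((σ - z.re) ^ 2 + (t - z.im) ^ 2)
      + (σ - 1 + z.re) / ((σ - 1 + z.re) ^ 2 + (t - z.im) ^ 2) := by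
  rw [stF, re_inv_sub_eq, re_inv_sub_one_sub_conj_eq]

/-- `F(s, 1 − z̄) = F(s, z)` (the pair is symmetric). [cite: McCurley1984ZFR, Lemma 4] -/
theorem stF_one_sub_conj (s z : ℂ) : stF s (1 - conj z) = stF s z := by
  unfold stF
  rw [map_sub, map_one, Complex.conj_conj, sub_sub_cancel, add_comm]

/-- **McCurley's Lemma 4 (Stechkin), first clause, at complex points.** For `σ ≥ 1`, real `t`,
`s = σ + it`, `s₁ = σ₁ + it` and `0 < Re z < 1`: `κ F(s₁, z) ≤ F(s, z)`.
[cite: McCurley1984ZFR, Lemma 4] -/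
theorem stechkin_stF {σ : ℝ} (hσ : 1 ≤ σ) {z : ℂ} (h0 : 0 < z.re) (h1 : z.re < 1) (t : ℝ) :
    kappa * stF (sigmaOne σ + t * I) z ≤ stF (σ + t * I) z := by
  rw [stF_eq, stF_eq]
  exact stechkin_real hσ h0 h1

/-- **McCurley's Lemma 4, second clause (the kept zero), at `t = Im z`.** For `σ ≥ 1` and
`0 < Re z ≤ 1`: `1/(σ − Re z) ≤ F(σ + iγ, z) − κ F(σ₁ + iγ, z)`, `γ = Im z` (McCurley: `½ ≤ Re z`;
the tree's `inv_sub_le_stechkinPair` covers `0 < Re z ≤ 1`). [cite: McCurley1984ZFR, Lemma 4 and §3 (25)–(26)] -/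
theorem inv_sub_le_stF {σ : ℝ} (hσ : 1 ≤ σ) {z : ℂ} (h0 : 0 < z.re) (h1 : z.re ≤ 1) :
    1 / (σ - z.re) ≤ stF (σ + z.im * I) z - kappa * stF (sigmaOne σ + z.im * I) z := by
  have e : ∀ x : ℝ, x / (x ^ 2 + (z.im - z.im) ^ 2) = 1 / x := fun x ↦ by
    rw [sub_self, zero_pow two_ne_zero, add_zero, sq, div_self_mul_self', one_div]
  rw [stF_eq, stF_eq, e, e, e, e]
  exact inv_sub_le_stechkinPair hσ h0 h1

end Stechkin

/-! ## McCurley's `f(t, χ)` and the Gamma difference -/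

section FAt

variable {q : ℕ} [NeZero q]

/-- McCurley's `f(t, χ) := Re(−L'/L(σ + it, χ)) − κ Re(−L'/L(σ₁ + it, χ))` (the parameter `σ` is
explicit). [cite: McCurley1984ZFR, §2 (5)] -/
def fAt (χ : DirichletCharacter ℂ q) (σ t : ℝ) : ℝ :=
  (-(deriv χ.LFunction (σ + t * I) / χ.LFunction (σ + t * I))).re
    - kappa * (-(deriv χ.LFunction (sigmaOne σ + t * I) / χ.LFunction (sigmaOne σ + t * I))).re

/-- The same for `ζ`: `f_ζ(t) := Re(−ζ'/ζ(σ + it)) − κ Re(−ζ'/ζ(σ₁ + it))`. [cite: McCurley1984ZFR, §2 (5), Lemma 7] -/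
def fAtZeta (σ t : ℝ) : ℝ :=
  (-(deriv riemannZeta (σ + t * I) / riemannZeta (σ + t * I))).re
    - kappa * (-(deriv riemannZeta (sigmaOne σ + t * I) / riemannZeta (sigmaOne σ + t * I))).re

/-- The Gamma difference `Re Γℝ'/Γℝ(σ + it + a) − κ Re Γℝ'/Γℝ(σ₁ + it + a)`
(`= ½[Re ψ((s+a)/2) − κ Re ψ((s₁+a)/2)] − K log π`, the quantity bounded in Lemmas 1–2).
[cite: McCurley1984ZFR, Lemmas 1–2 and (13)] -/
def gammaDiff (a : ℕ) (σ t : ℝ) : ℝ :=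
  (logDeriv Gammaℝ ((σ : ℂ) + t * I + a)).re - kappa * (logDeriv Gammaℝ ((sigmaOne σ : ℂ) + t * I + a)).re

/-- At `t = 0`, `f(0, χ) = f_χ(σ)` of the real-point files. [cite: McCurley1984ZFR, §2 (5)] -/
theorem fAt_zero (χ : DirichletCharacter ℂ q) (σ : ℝ) : fAt χ σ 0 = fdiff χ σ := by
  simp [fAt, fdiff]

/-- At `t = 0`, `f_ζ(0) = f_ζ(σ)` of the real-point files. [cite: McCurley1984ZFR, §2 (5)] -/
theorem fAtZeta_zero (σ : ℝ) : fAtZeta σ 0 = fdiffZeta σ := by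
  simp [fAtZeta, fdiffZeta]

/-- `f` in `logDeriv` form. [folklore] -/
private theorem fAt_eq_logDeriv (χ : DirichletCharacter ℂ q) (σ t : ℝ) :
    fAt χ σ t = -(logDeriv χ.LFunction (σ + t * I)).re
      + kappa * (logDeriv χ.LFunction (sigmaOne σ + t * I)).re := by
  simp only [fAt, logDeriv_apply, neg_re]
  ring

end FAt

end McCurleyStechkin

/-! ## Primitive characters: (13) Stechkin-differenced, Lemma 5 and the primitive case of Lemma 6 -/

namespace DirichletTheta

open McCurleyStechkin ExplicitPsiChar Literature.Analysis.Complex Literature.Analysis.Complex.HadamardGenusZero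

variable {q : ℕ} [NeZero q] {χ : DirichletCharacter ℂ q}

/-- **The involution `ρ ↦ 1 − ρ̄` of the zeros of `ξ(·, χ)` with multiplicity**, as a permutation
`(ρ, j) ↦ (1 − ρ̄, j)` of the index type (multiplicities agree:
`analyticOrderNatAt_dirichletXi_one_sub_conj`). McCurley: the zeros `z` and `1 − z̄` are summed
together in `F(s, z)`. [cite: McCurley1984ZFR, Lemma 4 and (13)] -/
def zerosRefl (hχ : χ.IsPrimitive) (h1 : χ ≠ 1) : ZIdx (dirichletXi χ) ≃ ZIdx (dirichletXi χ) :=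
  Equiv.subtypeEquiv
    (Function.Involutive.toPerm (fun p : ℂ × ℕ ↦ (1 - conj p.1, p.2)) fun p ↦ by simp) fun p ↦ by
      change _ ↔ dirichletXi χ (1 - conj p.1) = 0 ∧
        p.2 < analyticOrderNatAt (dirichletXi χ) (1 - conj p.1)
      rw [analyticOrderNatAt_dirichletXi_one_sub_conj hχ h1,
        ← analyticOrderNatAt_ne_zero_iff (differentiable_dirichletXi h1) (dirichletXi_zero_ne_zero hχ h1),
        ← analyticOrderNatAt_ne_zero_iff (differentiable_dirichletXi h1) (dirichletXi_zero_ne_zero hχ h1),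
        analyticOrderNatAt_dirichletXi_one_sub_conj hχ h1]

/-- The point of the reflected index is `1 − ρ̄`. [cite: McCurley1984ZFR, Lemma 4] -/
theorem zerosRefl_pt (hχ : χ.IsPrimitive) (h1 : χ ≠ 1) (i : ZIdx (dirichletXi χ)) :
    (zerosRefl hχ h1 i).pt = 1 - conj i.pt := rfl

/-- The reflection is an involution. [cite: McCurley1984ZFR, Lemma 4] -/
theorem zerosRefl_zerosRefl (hχ : χ.IsPrimitive) (h1 : χ ≠ 1) (i : ZIdx (dirichletXi χ)) :
    zerosRefl hχ h1 (zerosRefl hχ h1 i) = i := by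
  apply Subtype.ext
  simp [zerosRefl]

/-- `ξ(σ + it, χ) ≠ 0` for `σ ≥ 1`. [cite: MontgomeryVaughan2007, Cor 10.8] -/
private theorem dirichletXi_ne_zero_of_one_le (hχ : χ.IsPrimitive) (h1 : χ ≠ 1) {σ : ℝ}
    (hσ : 1 ≤ σ) (t : ℝ) : dirichletXi χ (σ + t * I) ≠ 0 :=
  dirichletXi_ne_zero_of_not_mem_strip hχ h1 (Or.inr (by simpa using hσ))

/-- `Re ξ'/ξ(σ + it, χ) = ½ log q + Re Γℝ'/Γℝ(s + a) + Re L'/L(s, χ)` for `σ ≥ 1`.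
[cite: MontgomeryVaughan2007, Theorem 14.5 (proof)] -/
private theorem re_logDeriv_dirichletXi (h1 : χ ≠ 1) {σ : ℝ} (hσ : 1 ≤ σ) (t : ℝ) :
    (deriv (dirichletXi χ) (σ + t * I) / dirichletXi χ (σ + t * I)).re =
      Real.log q / 2 + (logDeriv Gammaℝ ((σ : ℂ) + t * I + charParity χ)).re
        + (logDeriv χ.LFunction (σ + t * I)).re := by
  have hre : ((σ : ℂ) + t * I).re = σ := by simp
  have hL : χ.LFunction (σ + t * I) ≠ 0 :=
    DirichletCharacter.LFunction_ne_zero_of_one_le_re χ (Or.inl h1) (by rw [hre]; exact hσ)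
  have h := congrArg Complex.re (logDeriv_dirichletXi_eq h1 (s := σ + t * I) (by rw [hre]; linarith) hL)
  simp only [add_re, div_ofNat_re, ofReal_re] at h
  exact h

/-- **McCurley's (13), Stechkin-differenced, as an absolutely convergent series.** For `χ` primitive
mod `q`, `χ ≠ 1`, parity `a`, `σ ≥ 1`, real `t`, `s = σ + it`, `s₁ = σ₁ + it`:
`Σ_ρ [Re 1/(s − ρ) − κ Re 1/(s₁ − ρ)] = K log q + [Re Γℝ'/Γℝ(s+a) − κ Re Γℝ'/Γℝ(s₁+a)] − f(t, χ)`,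
the sum over the zeros of `ξ(·, χ)` with multiplicity. [cite: McCurley1984ZFR, (13)] -/
theorem hasSum_stechkinDiff (hχ : χ.IsPrimitive) (h1 : χ ≠ 1) {σ : ℝ} (hσ : 1 ≤ σ) (t : ℝ) :
    HasSum (fun i : ZIdx (dirichletXi χ) ↦
        (((σ : ℂ) + t * I - i.pt)⁻¹).re - kappa * (((sigmaOne σ : ℂ) + t * I - i.pt)⁻¹).re)
      (bigK * Real.log q + gammaDiff (charParity χ) σ t - fAt χ σ t) := by
  have hσ₁ : 1 ≤ sigmaOne σ := (one_lt_sigmaOne hσ).le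
  have h := (hasSum_re_inv_sub_zeros hχ h1 (dirichletXi_ne_zero_of_one_le hχ h1 hσ t)).sub
    ((hasSum_re_inv_sub_zeros hχ h1 (dirichletXi_ne_zero_of_one_le hχ h1 hσ₁ t)).mul_left kappa)
  rw [re_logDeriv_dirichletXi h1 hσ t, re_logDeriv_dirichletXi h1 hσ₁ t] at h
  have e : Real.log q / 2 + (logDeriv Gammaℝ ((σ : ℂ) + t * I + charParity χ)).re
      + (logDeriv χ.LFunction (σ + t * I)).re
      - kappa * (Real.log q / 2 + (logDeriv Gammaℝ ((sigmaOne σ : ℂ) + t * I + charParity χ)).re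
        + (logDeriv χ.LFunction (sigmaOne σ + t * I)).re) =
      bigK * Real.log q + gammaDiff (charParity χ) σ t - fAt χ σ t := by
    rw [fAt_eq_logDeriv]
    unfold bigK gammaDiff
    ring
  rwa [e] at h

/-- **(13) with Lemma 4: every finite set of pairs is dominated.** For `χ` primitive, `χ ≠ 1`,
`σ ≥ 1`, real `t`, and any finite set `S` of zero indices of `ξ(·, χ)`:
`Σ_{ρ ∈ S} ½[F(s,ρ) − κF(s₁,ρ)] ≤ K log q + Γ-terms − f(t, χ)` (each pair `{ρ, 1−ρ̄}` contributes
`F(s,ρ) − κF(s₁,ρ) ≥ 0`; an index and its reflection carry half each). [cite: McCurley1984ZFR, (13) and Lemma 4] -/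
theorem sum_pairs_le (hχ : χ.IsPrimitive) (h1 : χ ≠ 1) {σ : ℝ} (hσ : 1 ≤ σ) (t : ℝ)
    (S : Finset (ZIdx (dirichletXi χ))) :
    ∑ i ∈ S, (stF (σ + t * I) i.pt - kappa * stF (sigmaOne σ + t * I) i.pt) / 2 ≤
      bigK * Real.log q + gammaDiff (charParity χ) σ t - fAt χ σ t := by
  set g : ZIdx (dirichletXi χ) → ℝ := fun i ↦
    (((σ : ℂ) + t * I - i.pt)⁻¹).re - kappa * (((sigmaOne σ : ℂ) + t * I - i.pt)⁻¹).re with hg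
  have hS := hasSum_stechkinDiff hχ h1 hσ t
  have hS' : HasSum (g ∘ zerosRefl hχ h1) (bigK * Real.log q + gammaDiff (charParity χ) σ t - fAt χ σ t) :=
    (Equiv.hasSum_iff (zerosRefl hχ h1)).2 hS
  have hpair : HasSum (fun i ↦ (g i + g (zerosRefl hχ h1 i)) / 2)
      (bigK * Real.log q + gammaDiff (charParity χ) σ t - fAt χ σ t) := by
    have h2 := (hS.add hS').div_const 2
    have ev : (bigK * Real.log q + gammaDiff (charParity χ) σ t - fAt χ σ t
        + (bigK * Real.log q + gammaDiff (charParity χ) σ t - fAt χ σ t)) / 2 =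
        bigK * Real.log q + gammaDiff (charParity χ) σ t - fAt χ σ t := by ring
    rw [ev] at h2
    exact h2
  have hval : ∀ i, (g i + g (zerosRefl hχ h1 i)) / 2 =
      (stF (σ + t * I) i.pt - kappa * stF (sigmaOne σ + t * I) i.pt) / 2 := by
    intro i
    simp only [hg, zerosRefl_pt, stF]
    ring
  simp_rw [hval] at hpair
  refine sum_le_hasSum S (fun i _ ↦ ?_) hpair
  obtain ⟨-, h0, h1'⟩ := mem_charNontrivialZeros.1 (ZIdx_pt_mem_charNontrivialZeros hχ h1 i)
  have := stechkin_stF hσ h0 h1' t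
  linarith

/-- **McCurley's Lemma 6, primitive case (the zero sum discarded).** For `χ` primitive mod `q`,
`χ ≠ 1`, parity `a`, `σ ≥ 1`, real `t`:
`f(t, χ) ≤ K log q + [Re Γℝ'/Γℝ(σ+it+a) − κ Re Γℝ'/Γℝ(σ₁+it+a)]`. [cite: McCurley1984ZFR, Lemma 6 (proof: "(13) … and use Lemma 4 to discard the sum on ρ")] -/
theorem fAt_le (hχ : χ.IsPrimitive) (h1 : χ ≠ 1) {σ : ℝ} (hσ : 1 ≤ σ) (t : ℝ) :
    fAt χ σ t ≤ bigK * Real.log q + gammaDiff (charParity χ) σ t := by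
  have h := sum_pairs_le hχ h1 hσ t ∅
  rw [Finset.sum_empty] at h
  linarith

/-- A zero `ρ` of `L(s, χ)` with `Re ρ > 0` is a non-trivial zero (`Re ρ < 1`). [cite: MontgomeryVaughan2007, Cor 10.8] -/
private theorem re_lt_one_of_zero (h1 : χ ≠ 1) {ρ : ℂ} (hz : χ.LFunction ρ = 0) : ρ.re < 1 := by
  by_contra h
  exact DirichletCharacter.LFunction_ne_zero_of_one_le_re χ (Or.inl h1) (not_lt.1 h) hz

/-- **(14), general `t`: one zero kept.** For `χ` primitive, `χ ≠ 1`, `σ ≥ 1`, real `t`, and a zero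
`ρ = β + iγ` of `L(s, χ)` with `β > 0`, `β ≠ ½`:
`f(t, χ) ≤ K log q + Γ-terms − [F(s, ρ) − κ F(s₁, ρ)]` ("We discard all terms except for the one
corresponding to the zero of interest"). [cite: McCurley1984ZFR, Lemma 5 (14)] -/
theorem fAt_le_of_zero (hχ : χ.IsPrimitive) (h1 : χ ≠ 1) {σ : ℝ} (hσ : 1 ≤ σ) (t : ℝ) {ρ : ℂ}
    (hz : χ.LFunction ρ = 0) (h0 : 0 < ρ.re) (hhalf : ρ.re ≠ 1 / 2) :
    fAt χ σ t ≤ bigK * Real.log q + gammaDiff (charParity χ) σ t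
      - (stF (σ + t * I) ρ - kappa * stF (sigmaOne σ + t * I) ρ) := by
  classical
  have hd := differentiable_dirichletXi h1
  have hξ0 := dirichletXi_zero_ne_zero hχ h1
  have hρ1 := re_lt_one_of_zero h1 hz
  have hξρ : dirichletXi χ ρ = 0 :=
    (dirichletXi_eq_zero_iff_mem_charNontrivialZeros hχ h1 ρ).2 ⟨hz, h0, hρ1⟩
  have hpos : 0 < analyticOrderNatAt (dirichletXi χ) ρ :=
    Nat.pos_of_ne_zero ((analyticOrderNatAt_ne_zero_iff hd hξ0 ρ).2 hξρ)
  set i₀ : ZIdx (dirichletXi χ) := ⟨(ρ, 0), hξρ, hpos⟩ with hi₀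
  have hpt : i₀.pt = ρ := rfl
  have hne : i₀ ≠ zerosRefl hχ h1 i₀ := by
    intro h
    have h' := congrArg ZIdx.pt h
    rw [zerosRefl_pt, hpt] at h'
    have h'' := congrArg Complex.re h'
    simp only [sub_re, one_re, conj_re] at h''
    apply hhalf
    linarith
  have h := sum_pairs_le hχ h1 hσ t {i₀, zerosRefl hχ h1 i₀}
  rw [Finset.sum_pair hne, zerosRefl_pt, hpt, stF_one_sub_conj, stF_one_sub_conj] at h
  linarith

/-- **McCurley's Lemma 5 / (14): the kept zero at its own height.** For `χ` primitive, `χ ≠ 1`,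
`σ ≥ 1`, and a zero `ρ = β + iγ` of `L(s, χ)` with `β > 0`, `β ≠ ½`:
`f(γ, χ) ≤ K log q + [Re Γℝ'/Γℝ(σ+iγ+a) − κ Re Γℝ'/Γℝ(σ₁+iγ+a)] − 1/(σ − β)`.
[cite: McCurley1984ZFR, Lemma 5 (14)] -/
theorem fAt_le_of_zero_im (hχ : χ.IsPrimitive) (h1 : χ ≠ 1) {σ : ℝ} (hσ : 1 ≤ σ) {ρ : ℂ}
    (hz : χ.LFunction ρ = 0) (h0 : 0 < ρ.re) (hhalf : ρ.re ≠ 1 / 2) :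
    fAt χ σ ρ.im ≤ bigK * Real.log q + gammaDiff (charParity χ) σ ρ.im - 1 / (σ - ρ.re) := by
  have h := fAt_le_of_zero hχ h1 hσ ρ.im hz h0 hhalf
  have hP := inv_sub_le_stF hσ h0 (re_lt_one_of_zero h1 hz).le
  linarith

end DirichletTheta


/-! ## `ζ` and the principal character at complex points (Lemma 7, (17)–(19)) -/

section Zeta

open McCurleyStechkin

/-- The reflected zero of the tree's involution `FordL33.reflEquiv` (`ρ ↦ 1 − ρ̄` on the
non-trivial zeros of `ζ`; it preserves multiplicities, `riemannZetaZeroOrder_one_sub_conj`) is `1 − ρ̄`.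
[cite: McCurley1984ZFR, Lemma 4 and (18)] -/
theorem reflEquiv_coe (ρ : RHWave0.riemannZetaNontrivialZeros) :
    ((FordL33.reflEquiv ρ : RHWave0.riemannZetaNontrivialZeros) : ℂ) = 1 - conj (ρ : ℂ) := rfl

/-- **(18), Stechkin-differenced, as an absolutely convergent series.** For `σ > 1`, real `t`,
`s = σ + it`, `s₁ = σ₁ + it`:
`Σ_ρ m(ρ)[Re 1/(s−ρ) − κ Re 1/(s₁−ρ)] = [Re 1/(s−1) − κ Re 1/(s₁−1)] − K log π
  + ½[Re ψ(s/2+1) − κ Re ψ(s₁/2+1)] − f_ζ(t)` over the non-trivial zeros of `ζ` with multiplicity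
(de la Vallée Poussin's formula; Davenport Ch. 12). [cite: McCurley1984ZFR, Lemma 7 (18)–(19)] -/
theorem hasSum_zeta_stechkinDiff {σ : ℝ} (hσ : 1 < σ) (t : ℝ) :
    HasSum (fun ρ : RHWave0.riemannZetaNontrivialZeros ↦ (riemannZetaZeroOrder (ρ : ℂ) : ℝ) *
        ((1 / ((σ : ℂ) + t * I - ρ)).re - kappa * (1 / ((sigmaOne σ : ℂ) + t * I - ρ)).re))
      (((1 / ((σ : ℂ) + t * I - 1)).re - kappa * (1 / ((sigmaOne σ : ℂ) + t * I - 1)).re)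
        - bigK * Real.log π
        + ((Complex.digamma (((σ : ℂ) + t * I) / 2 + 1)).re
            - kappa * (Complex.digamma (((sigmaOne σ : ℂ) + t * I) / 2 + 1)).re) / 2
        - fAtZeta σ t) := by
  have hσ₁ : 1 < sigmaOne σ := one_lt_sigmaOne hσ.le
  -- the formula at one point `u + it`, `u > 1`
  have hpt : ∀ {u : ℝ}, 1 < u →
      HasSum (fun ρ : RHWave0.riemannZetaNontrivialZeros ↦
          (riemannZetaZeroOrder (ρ : ℂ) : ℝ) * (1 / ((u : ℂ) + t * I - ρ)).re)
        (-(Real.log π) / 2 + (Complex.digamma (((u : ℂ) + t * I) / 2 + 1)).re / 2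
          - (-(deriv riemannZeta (u + t * I) / riemannZeta (u + t * I))).re
          + (1 / ((u : ℂ) + t * I - 1)).re) := by
    intro u hu
    have hre : ((u : ℂ) + t * I).re = u := by simp
    have hζ : riemannZeta (u + t * I) ≠ 0 := riemannZeta_ne_zero_of_one_lt_re (by rw [hre]; exact hu)
    have h0 : (u : ℂ) + t * I ≠ 0 := fun h ↦ by
      have := congrArg Complex.re h; rw [hre, Complex.zero_re] at this; linarith
    have h1 : (u : ℂ) + t * I ≠ 1 := fun h ↦ by
      have := congrArg Complex.re h; rw [hre, Complex.one_re] at this; linarith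
    have hE := re_neg_logDeriv_zeta_hadamard (s := (u : ℂ) + t * I) (by rw [hre]; linarith) h0 h1 hζ
    have hS := (hasSum_zeroOrder_mul_re_inv_sub hζ)
    have hv : (logDeriv riemannXi ((u : ℂ) + t * I)).re =
        -(Real.log π) / 2 + (Complex.digamma (((u : ℂ) + t * I) / 2 + 1)).re / 2
          - (-(deriv riemannZeta (u + t * I) / riemannZeta (u + t * I))).re
          + (1 / ((u : ℂ) + t * I - 1)).re := by
      rw [← hS.tsum_eq]; linarith
    rwa [hv] at hS
  have h := (hpt hσ).sub ((hpt hσ₁).mul_left kappa)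
  have e : -(Real.log π) / 2 + (Complex.digamma (((σ : ℂ) + t * I) / 2 + 1)).re / 2
      - (-(deriv riemannZeta (σ + t * I) / riemannZeta (σ + t * I))).re
      + (1 / ((σ : ℂ) + t * I - 1)).re
      - kappa * (-(Real.log π) / 2 + (Complex.digamma (((sigmaOne σ : ℂ) + t * I) / 2 + 1)).re / 2
        - (-(deriv riemannZeta (sigmaOne σ + t * I) / riemannZeta (sigmaOne σ + t * I))).re
        + (1 / ((sigmaOne σ : ℂ) + t * I - 1)).re) =
      ((1 / ((σ : ℂ) + t * I - 1)).re - kappa * (1 / ((sigmaOne σ : ℂ) + t * I - 1)).re)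
        - bigK * Real.log π
        + ((Complex.digamma (((σ : ℂ) + t * I) / 2 + 1)).re
            - kappa * (Complex.digamma (((sigmaOne σ : ℂ) + t * I) / 2 + 1)).re) / 2
        - fAtZeta σ t := by
    unfold bigK fAtZeta
    ring
  rw [e] at h
  refine h.congr_fun fun ρ ↦ ?_
  ring

/-- **(18)–(19) with Lemma 4: every finite set of pairs of zeta zeros is dominated.**
[cite: McCurley1984ZFR, Lemma 7 (19) ("The terms of the sum on ρ in (19) are non-negative by Lemma 4")] -/
theorem sum_zeta_pairs_le {σ : ℝ} (hσ : 1 < σ) (t : ℝ)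
    (S : Finset RHWave0.riemannZetaNontrivialZeros) :
    ∑ ρ ∈ S, (riemannZetaZeroOrder (ρ : ℂ) : ℝ) *
        (stF (σ + t * I) ρ - kappa * stF (sigmaOne σ + t * I) ρ) / 2 ≤
      ((1 / ((σ : ℂ) + t * I - 1)).re - kappa * (1 / ((sigmaOne σ : ℂ) + t * I - 1)).re)
        - bigK * Real.log π
        + ((Complex.digamma (((σ : ℂ) + t * I) / 2 + 1)).re
            - kappa * (Complex.digamma (((sigmaOne σ : ℂ) + t * I) / 2 + 1)).re) / 2
        - fAtZeta σ t := by
  set V : ℝ := ((1 / ((σ : ℂ) + t * I - 1)).re - kappa * (1 / ((sigmaOne σ : ℂ) + t * I - 1)).re)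
        - bigK * Real.log π
        + ((Complex.digamma (((σ : ℂ) + t * I) / 2 + 1)).re
            - kappa * (Complex.digamma (((sigmaOne σ : ℂ) + t * I) / 2 + 1)).re) / 2
        - fAtZeta σ t with hV
  set g : RHWave0.riemannZetaNontrivialZeros → ℝ := fun ρ ↦ (riemannZetaZeroOrder (ρ : ℂ) : ℝ) *
    ((1 / ((σ : ℂ) + t * I - ρ)).re - kappa * (1 / ((sigmaOne σ : ℂ) + t * I - ρ)).re) with hg
  have hS : HasSum g V := hasSum_zeta_stechkinDiff hσ t
  have hS' : HasSum (g ∘ FordL33.reflEquiv) V := (Equiv.hasSum_iff FordL33.reflEquiv).2 hS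
  have hpair : HasSum (fun ρ ↦ (g ρ + g (FordL33.reflEquiv ρ)) / 2) V := by
    have h2 := (hS.add hS').div_const 2
    have ev : (V + V) / 2 = V := by ring
    rw [ev] at h2
    exact h2
  have hval : ∀ ρ : RHWave0.riemannZetaNontrivialZeros, (g ρ + g (FordL33.reflEquiv ρ)) / 2 =
      (riemannZetaZeroOrder (ρ : ℂ) : ℝ) *
        (stF (σ + t * I) ρ - kappa * stF (sigmaOne σ + t * I) ρ) / 2 := by
    intro ρ
    have h0 := ZetaZeros.riemannZetaNontrivialZeros.re_pos ρ.2
    have h1 := ZetaZeros.riemannZetaNontrivialZeros.re_lt_one ρ.2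
    simp only [hg, reflEquiv_coe, riemannZetaZeroOrder_one_sub_conj h0 h1, stF, one_div]
    ring
  simp_rw [hval] at hpair
  refine sum_le_hasSum S (fun ρ _ ↦ ?_) hpair
  have h0 := ZetaZeros.riemannZetaNontrivialZeros.re_pos ρ.2
  have h1 := ZetaZeros.riemannZetaNontrivialZeros.re_lt_one ρ.2
  have hm : (1 : ℝ) ≤ (riemannZetaZeroOrder (ρ : ℂ) : ℝ) := by
    exact_mod_cast ZetaZeros.riemannZetaNontrivialZeros.one_le_order ρ.2
  have hst := stechkin_stF hσ.le h0 h1 t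
  have : 0 ≤ stF (σ + t * I) ρ - kappa * stF (sigmaOne σ + t * I) ρ := by linarith
  positivity

/-- **McCurley's Lemma 7 core (zero sum discarded).** For `σ > 1` and real `t`:
`f_ζ(t) ≤ [Re 1/(s−1) − κ Re 1/(s₁−1)] − K log π + ½[Re ψ(s/2+1) − κ Re ψ(s₁/2+1)]`.
[cite: McCurley1984ZFR, Lemma 7 (18)–(19)] -/
theorem fAtZeta_le {σ : ℝ} (hσ : 1 < σ) (t : ℝ) :
    fAtZeta σ t ≤
      ((1 / ((σ : ℂ) + t * I - 1)).re - kappa * (1 / ((sigmaOne σ : ℂ) + t * I - 1)).re)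
        - bigK * Real.log π
        + ((Complex.digamma (((σ : ℂ) + t * I) / 2 + 1)).re
            - kappa * (Complex.digamma (((sigmaOne σ : ℂ) + t * I) / 2 + 1)).re) / 2 := by
  have h := sum_zeta_pairs_le hσ t ∅
  rw [Finset.sum_empty] at h
  linarith

/-- **Lemma 7 core with one zeta zero kept.** For `σ > 1`, real `t`, and a zero `ρ = β + iγ` of `ζ`
with `0 < β < 1`, `β ≠ ½`: `f_ζ(t) ≤ [pole terms] − K log π + ½[ψ terms] − [F(s,ρ) − κF(s₁,ρ)]`.
[cite: McCurley1984ZFR, Lemma 7 (19) and Lemma 4] -/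
theorem fAtZeta_le_of_zero {σ : ℝ} (hσ : 1 < σ) (t : ℝ) {ρ : ℂ} (hz : riemannZeta ρ = 0)
    (h0 : 0 < ρ.re) (h1 : ρ.re < 1) (hhalf : ρ.re ≠ 1 / 2) :
    fAtZeta σ t ≤
      ((1 / ((σ : ℂ) + t * I - 1)).re - kappa * (1 / ((sigmaOne σ : ℂ) + t * I - 1)).re)
        - bigK * Real.log π
        + ((Complex.digamma (((σ : ℂ) + t * I) / 2 + 1)).re
            - kappa * (Complex.digamma (((sigmaOne σ : ℂ) + t * I) / 2 + 1)).re) / 2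
        - (stF (σ + t * I) ρ - kappa * stF (sigmaOne σ + t * I) ρ) := by
  classical
  have hρ : ρ ∈ RHWave0.riemannZetaNontrivialZeros :=
    ZetaZeros.riemannZetaNontrivialZeros.mem_iff'.2 ⟨hz, h0, h1⟩
  set i₀ : RHWave0.riemannZetaNontrivialZeros := ⟨ρ, hρ⟩ with hi₀
  have hne : i₀ ≠ FordL33.reflEquiv i₀ := by
    intro h
    have h' := congrArg (fun j : RHWave0.riemannZetaNontrivialZeros ↦ ((j : ℂ)).re) h
    simp only [reflEquiv_coe, sub_re, one_re, conj_re, hi₀] at h'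
    apply hhalf
    linarith
  have h := sum_zeta_pairs_le hσ t {i₀, FordL33.reflEquiv i₀}
  rw [Finset.sum_pair hne, reflEquiv_coe] at h
  simp only [hi₀] at h
  rw [riemannZetaZeroOrder_one_sub_conj h0 h1] at h
  simp only [stF_one_sub_conj] at h
  have hm : (1 : ℝ) ≤ (riemannZetaZeroOrder ρ : ℝ) := by
    exact_mod_cast ZetaZeros.riemannZetaNontrivialZeros.one_le_order hρ
  have hst := stechkin_stF hσ.le h0 h1 t
  have hnn : 0 ≤ stF (σ + t * I) ρ - kappa * stF (sigmaOne σ + t * I) ρ := by linarith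
  have hle : stF (σ + t * I) ρ - kappa * stF (sigmaOne σ + t * I) ρ ≤
      (riemannZetaZeroOrder ρ : ℝ) * (stF (σ + t * I) ρ - kappa * stF (sigmaOne σ + t * I) ρ) :=
    le_mul_of_one_le_left hnn hm
  linarith

end Zeta

/-! ## Induced characters at complex points (Lemma 6, (15)–(16)) and the principal character -/

namespace McCurleyStechkin

section EulerComplex

open DirichletCharacter

/-- `‖w · p^{−it}‖ ≤ 1` for `‖w‖ ≤ 1`, `p ≥ 1`. [folklore] -/
private theorem norm_mul_cpow_neg_mul_I_le {w : ℂ} (hw : ‖w‖ ≤ 1) {p : ℕ} (hp : 0 < p) (t : ℝ) :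
    ‖w * (p : ℂ) ^ (-(t * I))‖ ≤ 1 := by
  rw [norm_mul, Complex.norm_natCast_cpow_of_pos hp]
  simp only [neg_re, mul_re, ofReal_re, I_re, mul_zero, ofReal_im, I_im, mul_one, sub_self,
    neg_zero, Real.rpow_zero, mul_one]
  exact hw

/-- `p^{−(σ+it)} = p^{−it} · p^{−σ}` with the real factor as a real power. [folklore] -/
private theorem cpow_neg_add_eq {p : ℕ} (hp : 2 ≤ p) (σ t : ℝ) :
    (p : ℂ) ^ (-((σ : ℂ) + t * I)) = (p : ℂ) ^ (-(t * I)) * (((p : ℝ) ^ (-σ) : ℝ) : ℂ) := by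
  have hp0 : (p : ℂ) ≠ 0 := by exact_mod_cast (show p ≠ 0 by omega)
  have hpow : (p : ℂ) ^ (-(σ : ℂ)) = (((p : ℝ) ^ (-σ) : ℝ) : ℂ) := by
    rw [Complex.ofReal_cpow (Nat.cast_nonneg p), Complex.ofReal_natCast, Complex.ofReal_neg]
  rw [neg_add, Complex.cpow_add _ _ hp0, hpow, mul_comm]

/-- **The log-derivative of an Euler factor at a complex point.** For `p ≥ 2`, `‖w‖ ≤ 1`, `σ > 0`,
real `t`: `1 − w p^{−(σ+it)} ≠ 0`, `s ↦ 1 − w p^{−s}` is differentiable at `σ + it`, and its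
logarithmic derivative there is `e(w p^{−it}, p, σ)`. [cite: McCurley1984ZFR, Lemma 6 (15)] -/
theorem logDeriv_eulerFactorC_complex {p : ℕ} (hp : 2 ≤ p) {w : ℂ} (hw : ‖w‖ ≤ 1) {σ : ℝ}
    (hσ : 0 < σ) (t : ℝ) :
    (1 - w * (p : ℂ) ^ (-((σ : ℂ) + t * I)) ≠ 0) ∧
    DifferentiableAt ℂ (fun s : ℂ ↦ 1 - w * (p : ℂ) ^ (-s)) ((σ : ℂ) + t * I) ∧
    logDeriv (fun s : ℂ ↦ 1 - w * (p : ℂ) ^ (-s)) ((σ : ℂ) + t * I) =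
      eulerCorrC (w * (p : ℂ) ^ (-(t * I))) p σ := by
  have hp0 : (p : ℂ) ≠ 0 := by exact_mod_cast (show p ≠ 0 by omega)
  have hw' := norm_mul_cpow_neg_mul_I_le hw (show 0 < p by omega) t
  have hsplit := cpow_neg_add_eq hp σ t
  have hpow : (p : ℂ) ^ (-(σ : ℂ)) = (((p : ℝ) ^ (-σ) : ℝ) : ℂ) := by
    rw [Complex.ofReal_cpow (Nat.cast_nonneg p), Complex.ofReal_natCast, Complex.ofReal_neg]
  have hne := (logDeriv_eulerFactorC hp hw' hσ).1
  rw [hpow] at hne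
  have hneC : (1 : ℂ) - w * (p : ℂ) ^ (-((σ : ℂ) + t * I)) ≠ 0 := by
    rw [hsplit, ← mul_assoc]; exact hne
  have hd : HasDerivAt (fun s : ℂ ↦ 1 - w * (p : ℂ) ^ (-s))
      (-(w * ((p : ℂ) ^ (-((σ : ℂ) + t * I)) * Complex.log p * (-1)))) ((σ : ℂ) + t * I) := by
    have h1 : HasDerivAt (fun s : ℂ ↦ -s) (-1) ((σ : ℂ) + t * I) := (hasDerivAt_id _).neg
    have h2 := h1.const_cpow (c := (p : ℂ)) (Or.inl hp0)
    exact (h2.const_mul w).const_sub 1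
  refine ⟨hneC, hd.differentiableAt, ?_⟩
  rw [logDeriv_apply, hd.deriv]
  unfold eulerCorrC
  have hlog : Complex.log (p : ℂ) = ((Real.log p : ℝ) : ℂ) := by
    rw [← Complex.ofReal_natCast, Complex.ofReal_log (Nat.cast_nonneg p)]
  rw [hsplit, hlog]
  have hden : (1 : ℂ) - w * ((p : ℂ) ^ (-(t * I)) * (((p : ℝ) ^ (-σ) : ℝ) : ℂ)) =
      1 - w * (p : ℂ) ^ (-(t * I)) * (((p : ℝ) ^ (-σ) : ℝ) : ℂ) := by ring
  rw [hden]
  ring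

variable {d N : ℕ} [NeZero d] [NeZero N]

/-- **The log-derivative of an induced character's `L`-function at a complex point `σ + it`,
`σ > 1`.** For `ψ` mod `d ∣ N` (any `ψ`):
`Re(−L'/L(s, ψ mod N)) = Re(−L'/L(s, ψ)) − Σ_{p ∣ N} Re e(ψ(p)p^{−it}, p, σ)`.
[cite: McCurley1984ZFR, Lemma 6 (15)–(16)] -/
theorem re_negLogDeriv_changeLevel_complex (ψ : DirichletCharacter ℂ d) (hd : d ∣ N) {σ : ℝ}
    (hσ : 1 < σ) (t : ℝ) :
    (-(deriv (changeLevel hd ψ).LFunction (σ + t * I) / (changeLevel hd ψ).LFunction (σ + t * I))).re =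
      (-(deriv ψ.LFunction (σ + t * I) / ψ.LFunction (σ + t * I))).re
        - ∑ p ∈ N.primeFactors, (eulerCorrC (ψ p * (p : ℂ) ^ (-(t * I))) p σ).re := by
  set s₀ : ℂ := (σ : ℂ) + t * I with hs₀
  have hre : s₀.re = σ := by simp [hs₀]
  have hσ0 : 0 < σ := by linarith
  have hs1 : s₀ ≠ 1 := fun h ↦ by
    have := congrArg Complex.re h; rw [hre, Complex.one_re] at this; linarith
  set g : ℂ → ℂ := fun s ↦ ψ.LFunction s * ∏ p ∈ N.primeFactors, (1 - ψ p * (p : ℂ) ^ (-s))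
    with hgdef
  have hEq : (changeLevel hd ψ).LFunction =ᶠ[nhds s₀] g := by
    have hopen : IsOpen ({1}ᶜ : Set ℂ) := isOpen_compl_singleton
    filter_upwards [hopen.mem_nhds (show s₀ ∈ ({1}ᶜ : Set ℂ) from hs1)] with s hs
    exact LFunction_changeLevel hd ψ (Or.inr hs)
  have hval : (changeLevel hd ψ).LFunction s₀ = g s₀ := hEq.eq_of_nhds
  have hder : deriv (changeLevel hd ψ).LFunction s₀ = deriv g s₀ := hEq.deriv_eq
  have hLt : ψ.LFunction s₀ ≠ 0 := LFunction_ne_zero_of_one_le_re ψ (Or.inr hs1) (by rw [hre]; exact hσ.le)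
  have hw : ∀ p : ℕ, ‖ψ (p : ZMod d)‖ ≤ 1 := fun p ↦ ψ.norm_le_one _
  have hfac : ∀ p ∈ N.primeFactors,
      (1 - ψ p * (p : ℂ) ^ (-s₀) ≠ 0) ∧
      DifferentiableAt ℂ (fun s : ℂ ↦ 1 - ψ p * (p : ℂ) ^ (-s)) s₀ ∧
      logDeriv (fun s : ℂ ↦ 1 - ψ p * (p : ℂ) ^ (-s)) s₀ =
        eulerCorrC (ψ p * (p : ℂ) ^ (-(t * I))) p σ :=
    fun p hp ↦ logDeriv_eulerFactorC_complex (Nat.prime_of_mem_primeFactors hp).two_le (hw p) hσ0 t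
  have hE : (∏ p ∈ N.primeFactors, (1 - ψ p * (p : ℂ) ^ (-s₀))) ≠ 0 :=
    Finset.prod_ne_zero_iff.2 fun p hp ↦ (hfac p hp).1
  have hEd : DifferentiableAt ℂ
      (fun s : ℂ ↦ ∏ p ∈ N.primeFactors, (1 - ψ p * (p : ℂ) ^ (-s))) s₀ :=
    DifferentiableAt.fun_finsetProd fun p hp ↦ (hfac p hp).2.1
  have hLd : DifferentiableAt ℂ ψ.LFunction s₀ := differentiableAt_LFunction ψ s₀ (Or.inl hs1)
  have h1 : logDeriv g s₀ = logDeriv ψ.LFunction s₀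
      + ∑ p ∈ N.primeFactors, eulerCorrC (ψ p * (p : ℂ) ^ (-(t * I))) p σ := by
    rw [hgdef, logDeriv_mul s₀ hLt hE hLd hEd,
      logDeriv_prod (fun p hp ↦ (hfac p hp).1) (fun p hp ↦ (hfac p hp).2.1)]
    congr 1
    exact Finset.sum_congr rfl fun p hp ↦ (hfac p hp).2.2
  have h0 : logDeriv (changeLevel hd ψ).LFunction s₀ = logDeriv g s₀ := by
    rw [logDeriv_apply, logDeriv_apply, hval, hder]
  have h2 := congrArg Complex.re (h0.trans h1)
  rw [logDeriv_apply, logDeriv_apply, add_re, Complex.re_sum] at h2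
  rw [neg_re, neg_re, h2]
  ring

/-- The same in `f(t, ·)` form: `f(t, ψ mod N) = f(t, ψ) + Σ_{p∣N} corr(ψ(p)p^{−it}, p, σ)`,
`corr(w,p,σ) = −[Re e(w,p,σ) − κ Re e(w,p,σ₁)]`. [cite: McCurley1984ZFR, Lemma 6 (16)] -/
theorem fAt_changeLevel_eq (ψ : DirichletCharacter ℂ d) (hd : d ∣ N) {σ : ℝ} (hσ : 1 < σ) (t : ℝ) :
    fAt (changeLevel hd ψ) σ t = fAt ψ σ t
      + ∑ p ∈ N.primeFactors, corrC (ψ p * (p : ℂ) ^ (-(t * I))) p σ := by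
  have hσ₁ : 1 < sigmaOne σ := one_lt_sigmaOne hσ.le
  unfold fAt corrC
  rw [re_negLogDeriv_changeLevel_complex ψ hd hσ, re_negLogDeriv_changeLevel_complex ψ hd hσ₁,
    Finset.sum_neg_distrib, Finset.sum_sub_distrib, ← Finset.mul_sum]
  ring

/-- `f(t, ·)` of the trivial character mod `1` is `f_ζ(t)`. [folklore] -/
private theorem fAt_modOne (σ t : ℝ) : fAt (1 : DirichletCharacter ℂ 1) σ t = fAtZeta σ t := by
  unfold fAt fAtZeta
  rw [LFunction_modOne_eq]

/-- **The principal character at a complex point.**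
`f(t, χ₀ mod k) = f_ζ(t) + Σ_{p∣k} corr(p^{−it}, p, σ)`. [cite: McCurley1984ZFR, Lemma 7 (17)] -/
theorem fAt_one_eq (k : ℕ) [NeZero k] {σ : ℝ} (hσ : 1 < σ) (t : ℝ) :
    fAt (1 : DirichletCharacter ℂ k) σ t = fAtZeta σ t
      + ∑ p ∈ k.primeFactors, corrC ((p : ℂ) ^ (-(t * I))) p σ := by
  have h := fAt_changeLevel_eq (1 : DirichletCharacter ℂ 1) (one_dvd k) hσ t
  rw [changeLevel_one, fAt_modOne] at h
  rw [h]
  congr 1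
  refine Finset.sum_congr rfl fun p _ ↦ ?_
  rw [MulChar.one_apply (isUnit_of_subsingleton _), one_mul]

/-- **The principal character, bounded (McCurley's `T(k, 1)`).** For `σ > 1`, real `t`:
`f(t, χ₀ mod k) ≤ f_ζ(t) + Σ_{p∣k} [U(p,σ) + κ U(p,σ₁)]`. [cite: McCurley1984ZFR, Lemma 7] -/
theorem fAt_one_le (k : ℕ) [NeZero k] {σ : ℝ} (hσ : 1 < σ) (t : ℝ) :
    fAt (1 : DirichletCharacter ℂ k) σ t ≤ fAtZeta σ t
      + ∑ p ∈ k.primeFactors, (uCorr p σ + kappa * uCorr p (sigmaOne σ)) := by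
  rw [fAt_one_eq k hσ t]
  gcongr with p hp
  have hp := (Nat.prime_of_mem_primeFactors hp)
  have hw : ‖(p : ℂ) ^ (-(t * I))‖ ≤ 1 := by
    have := norm_mul_cpow_neg_mul_I_le (w := 1) (by simp) hp.pos t
    rwa [one_mul] at this
  have h := corrC_le hp.two_le hw hσ
  have hσ₁ : 1 < sigmaOne σ := one_lt_sigmaOne hσ.le
  have hu : 0 ≤ uCorr p σ + kappa * uCorr p (sigmaOne σ) :=
    add_nonneg (uCorr_nonneg hp.two_le (by linarith))
      (mul_nonneg kappa_pos.le (uCorr_nonneg hp.two_le (by linarith)))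
  split_ifs at h <;> linarith

omit [NeZero d] [NeZero N] in
/-- The parity `a = (1 − χ(−1))/2` is unchanged by inducing (`χ(−1) = χ₁(−1)`, `−1` being a unit);
McCurley applies the primitive-case bound to `χ₁` with the same `a`. [cite: McCurley1984ZFR, Lemma 6 (proof)] -/
theorem charParity_changeLevel (ψ : DirichletCharacter ℂ d) (hd : d ∣ N) :
    charParity (changeLevel hd ψ) = charParity ψ := by
  have h : (changeLevel hd ψ) (-1) = ψ (-1) := by
    have := changeLevel_eq_cast_of_dvd' ψ hd (a := -1) (isCoprime_one_left.neg_left)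
    push_cast at this
    exact this
  unfold charParity
  by_cases he : ψ.Even
  · have he' : (changeLevel hd ψ).Even := by unfold DirichletCharacter.Even at *; rw [h]; exact he
    rw [if_pos he, if_pos he']
  · have he' : ¬(changeLevel hd ψ).Even := by unfold DirichletCharacter.Even at *; rw [h]; exact he
    rw [if_neg he, if_neg he']

/-- The primes `p ∣ k` at which the primitive character `ψ₁` (conductor `d`) inducing `ψ` does not
vanish do not divide `d`, so their product divides `k/d`:
`Σ_{p∣k, ψ₁(p) ≠ 0} log p ≤ log k − log d`. [cite: McCurley1984ZFR, Lemma 6 (16)] -/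
private theorem sum_log_support_le {k : ℕ} [NeZero k] (ψ : DirichletCharacter ℂ k) :
    ∑ p ∈ k.primeFactors, (if ψ.primitiveCharacter p = 0 then (0 : ℝ) else Real.log p) ≤
      Real.log k - Real.log ψ.conductor := by
  classical
  haveI : NeZero ψ.conductor := ⟨conductor_ne_zero ψ⟩
  set d := ψ.conductor with hddef
  set ψ₁ := ψ.primitiveCharacter with hψ₁def
  set S : Finset ℕ := k.primeFactors.filter (fun p : ℕ ↦ ¬ ψ₁ (p : ZMod d) = 0) with hSdef
  have hSum : ∑ p ∈ k.primeFactors, (if ψ₁ p = 0 then (0 : ℝ) else Real.log p) =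
      ∑ p ∈ S, Real.log (p : ℝ) := by
    rw [hSdef, Finset.sum_filter]
    exact Finset.sum_congr rfl fun p _ ↦ by by_cases h : ψ₁ (p : ZMod d) = 0 <;> simp [h]
  rw [hSum]
  have hSprime : ∀ p ∈ S, p.Prime := fun p hp ↦
    Nat.prime_of_mem_primeFactors (Finset.mem_filter.1 hp).1
  have hdk : d ∣ k := ψ.conductor_dvd_level
  have hSdvd : ∀ p ∈ S, p ∣ k / d := by
    intro p hp
    obtain ⟨hpk, hcp⟩ := Finset.mem_filter.1 hp
    have hpP := Nat.prime_of_mem_primeFactors hpk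
    have hpdk : p ∣ k := Nat.dvd_of_mem_primeFactors hpk
    have hnd : ¬ p ∣ d := by
      intro hpd
      apply hcp
      have hnu : ¬IsUnit ((p : ZMod d)) := fun hu ↦ ((ZMod.isUnit_prime_iff_not_dvd hpP).1 hu) hpd
      exact MulChar.map_nonunit _ hnu
    have hk' : k = d * (k / d) := (Nat.mul_div_cancel' hdk).symm
    rw [hk'] at hpdk
    exact ((Nat.Prime.dvd_mul hpP).1 hpdk).resolve_left hnd
  have hprod : ∏ p ∈ S, p ∣ k / d :=
    Finset.prod_primes_dvd (k / d) (fun p hp ↦ Nat.prime_iff.1 (hSprime p hp)) hSdvd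
  have hkd : 0 < k / d := Nat.div_pos (Nat.le_of_dvd (Nat.pos_of_ne_zero (NeZero.ne k)) hdk)
    (Nat.pos_of_ne_zero (NeZero.ne d))
  have hle : (∏ p ∈ S, (p : ℝ)) ≤ (k : ℝ) / d := by
    have h := Nat.le_of_dvd hkd hprod
    have h' : ((∏ p ∈ S, p : ℕ) : ℝ) ≤ ((k / d : ℕ) : ℝ) := by exact_mod_cast h
    rw [Nat.cast_prod, Nat.cast_div hdk (by exact_mod_cast NeZero.ne d)] at h'
    exact h'
  have hpos : 0 < ∏ p ∈ S, (p : ℝ) :=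
    Finset.prod_pos fun p hp ↦ by exact_mod_cast (hSprime p hp).pos
  calc ∑ p ∈ S, Real.log p = Real.log (∏ p ∈ S, (p : ℝ)) := by
        rw [Real.log_prod fun p hp ↦ by exact_mod_cast (hSprime p hp).ne_zero]
    _ ≤ Real.log ((k : ℝ) / d) := Real.log_le_log hpos hle
    _ = Real.log k - Real.log d := by
        rw [Real.log_div (by exact_mod_cast NeZero.ne k) (by exact_mod_cast NeZero.ne d)]

/-- **McCurley's Lemma 6 at a complex point (induced case; Gamma terms symbolic).** For any
`ψ ≠ 1` mod `k` with parity `a`, `σ > 1`, real `t`: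
`f(t, ψ) ≤ K log k + [Re Γℝ'/Γℝ(σ+it+a) − κ Re Γℝ'/Γℝ(σ₁+it+a)] + Σ_{p∣k} max(G(p,σ), 0)`
(pass to the primitive `ψ₁` mod `d`: `f(t,ψ₁) ≤ K log d + Γ-terms`; each `p ∣ k` with `ψ₁(p) ≠ 0`
costs at most `U(p,σ) + κU(p,σ₁)`, and these primes multiply to a divisor of `k/d`; McCurley's
`T(k, k₁)`). [cite: McCurley1984ZFR, Lemma 6 (16)] -/
theorem fAt_induced_le {k : ℕ} [NeZero k] (ψ : DirichletCharacter ℂ k) (hψ1 : ψ ≠ 1) {σ : ℝ}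
    (hσ : 1 < σ) (t : ℝ) :
    fAt ψ σ t ≤ bigK * Real.log k + gammaDiff (charParity ψ) σ t
      + ∑ p ∈ k.primeFactors, max (gPen p σ) 0 := by
  classical
  haveI : NeZero ψ.conductor := ⟨conductor_ne_zero ψ⟩
  set d := ψ.conductor with hddef
  set ψ₁ := ψ.primitiveCharacter with hψ₁def
  have hind : changeLevel ψ.conductor_dvd_level ψ₁ = ψ := changeLevel_primitiveCharacter ψ
  have hψ₁1 : ψ₁ ≠ 1 := by
    intro h; apply hψ1; rw [← hind, h]; exact changeLevel_one _
  have hψ₁p : ψ₁.IsPrimitive := primitiveCharacter_isPrimitive ψ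
  have hpar : charParity ψ₁ = charParity ψ := by
    rw [← charParity_changeLevel ψ₁ ψ.conductor_dvd_level, hind]
  -- the primitive character
  have hprim : fAt ψ₁ σ t ≤ bigK * Real.log d + gammaDiff (charParity ψ) σ t := by
    rw [← hpar]; exact DirichletTheta.fAt_le hψ₁p hψ₁1 hσ.le t
  -- the Euler corrections
  have hrel : fAt ψ σ t = fAt ψ₁ σ t + ∑ p ∈ k.primeFactors, corrC (ψ₁ p * (p : ℂ) ^ (-(t * I))) p σ := by
    have h := fAt_changeLevel_eq ψ₁ ψ.conductor_dvd_level hσ t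
    rwa [hind] at h
  have hw : ∀ p ∈ k.primeFactors, ‖ψ₁ (p : ZMod d) * (p : ℂ) ^ (-(t * I))‖ ≤ 1 := fun p hp ↦
    norm_mul_cpow_neg_mul_I_le (ψ₁.norm_le_one _) (Nat.prime_of_mem_primeFactors hp).pos t
  have hw0 : ∀ p ∈ k.primeFactors, (ψ₁ (p : ZMod d) * (p : ℂ) ^ (-(t * I)) = 0 ↔ ψ₁ (p : ZMod d) = 0) := by
    intro p hp
    have hp0 : (p : ℂ) ≠ 0 := by exact_mod_cast (Nat.prime_of_mem_primeFactors hp).ne_zero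
    have hc : (p : ℂ) ^ (-(t * I)) ≠ 0 := by
      rw [Ne, Complex.cpow_eq_zero_iff, not_and_or]; exact Or.inl hp0
    exact ⟨fun h ↦ (mul_eq_zero.1 h).resolve_right hc, fun h ↦ by rw [h, zero_mul]⟩
  have hstep : ∑ p ∈ k.primeFactors, corrC (ψ₁ p * (p : ℂ) ^ (-(t * I))) p σ ≤
      ∑ p ∈ k.primeFactors, max (gPen p σ) 0 +
        bigK * ∑ p ∈ k.primeFactors, (if ψ₁ p = 0 then 0 else Real.log p) := by
    rw [Finset.mul_sum, ← Finset.sum_add_distrib]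
    refine Finset.sum_le_sum fun p hp ↦ ?_
    have h := index_term_le (Nat.prime_of_mem_primeFactors hp).two_le (hw p hp) hσ zero_le_one
    simp only [one_mul, mul_one, hw0 p hp] at h
    linarith
  have hlog := sum_log_support_le ψ
  have hK := bigK_pos
  have := mul_le_mul_of_nonneg_left hlog hK.le
  rw [hrel]
  linarith

/-- **McCurley's Lemma 6 with the zero kept (induced case), at the zero's height.** For `ψ ≠ 1`
mod `k` (any), `σ > 1`, and a zero `ρ = β + iγ` of `L(s, ψ)` with `β > 0`, `β ≠ ½`:
`f(γ, ψ) ≤ K log k + Γ-terms + Σ_{p∣k} max(G(p,σ),0) − 1/(σ − β)`.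
[cite: McCurley1984ZFR, Lemmas 5–6, §4 (29)] -/
theorem fAt_induced_le_of_zero_im {k : ℕ} [NeZero k] (ψ : DirichletCharacter ℂ k) (hψ1 : ψ ≠ 1)
    {σ : ℝ} (hσ : 1 < σ) {ρ : ℂ} (hz : ψ.LFunction ρ = 0) (h0 : 0 < ρ.re) (hhalf : ρ.re ≠ 1 / 2) :
    fAt ψ σ ρ.im ≤ bigK * Real.log k + gammaDiff (charParity ψ) σ ρ.im
      + ∑ p ∈ k.primeFactors, max (gPen p σ) 0 - 1 / (σ - ρ.re) := by
  classical
  haveI : NeZero ψ.conductor := ⟨conductor_ne_zero ψ⟩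
  set d := ψ.conductor with hddef
  set ψ₁ := ψ.primitiveCharacter with hψ₁def
  have hind : changeLevel ψ.conductor_dvd_level ψ₁ = ψ := changeLevel_primitiveCharacter ψ
  have hψ₁1 : ψ₁ ≠ 1 := by
    intro h; apply hψ1; rw [← hind, h]; exact changeLevel_one _
  have hψ₁p : ψ₁.IsPrimitive := primitiveCharacter_isPrimitive ψ
  have hpar : charParity ψ₁ = charParity ψ := by
    rw [← charParity_changeLevel ψ₁ ψ.conductor_dvd_level, hind]
  have hρne : ρ ≠ 1 := fun h ↦
    LFunction_ne_zero_of_one_le_re ψ (Or.inl hψ1) (by rw [h, Complex.one_re]) hz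
  have hz₁ : ψ₁.LFunction ρ = 0 := (ψ.LFunction_eq_zero_iff_primitiveCharacter h0 hρne).1 hz
  have hprim : fAt ψ₁ σ ρ.im ≤ bigK * Real.log d + gammaDiff (charParity ψ) σ ρ.im - 1 / (σ - ρ.re) := by
    rw [← hpar]; exact DirichletTheta.fAt_le_of_zero_im hψ₁p hψ₁1 hσ.le hz₁ h0 hhalf
  have hrel : fAt ψ σ ρ.im = fAt ψ₁ σ ρ.im
      + ∑ p ∈ k.primeFactors, corrC (ψ₁ p * (p : ℂ) ^ (-(ρ.im * I))) p σ := by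
    have h := fAt_changeLevel_eq ψ₁ ψ.conductor_dvd_level hσ ρ.im
    rwa [hind] at h
  have hw : ∀ p ∈ k.primeFactors, ‖ψ₁ (p : ZMod d) * (p : ℂ) ^ (-(ρ.im * I))‖ ≤ 1 := fun p hp ↦
    norm_mul_cpow_neg_mul_I_le (ψ₁.norm_le_one _) (Nat.prime_of_mem_primeFactors hp).pos ρ.im
  have hw0 : ∀ p ∈ k.primeFactors,
      (ψ₁ (p : ZMod d) * (p : ℂ) ^ (-(ρ.im * I)) = 0 ↔ ψ₁ (p : ZMod d) = 0) := by
    intro p hp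
    have hp0 : (p : ℂ) ≠ 0 := by exact_mod_cast (Nat.prime_of_mem_primeFactors hp).ne_zero
    have hc : (p : ℂ) ^ (-(ρ.im * I)) ≠ 0 := by
      rw [Ne, Complex.cpow_eq_zero_iff, not_and_or]; exact Or.inl hp0
    exact ⟨fun h ↦ (mul_eq_zero.1 h).resolve_right hc, fun h ↦ by rw [h, zero_mul]⟩
  have hstep : ∑ p ∈ k.primeFactors, corrC (ψ₁ p * (p : ℂ) ^ (-(ρ.im * I))) p σ ≤
      ∑ p ∈ k.primeFactors, max (gPen p σ) 0 +
        bigK * ∑ p ∈ k.primeFactors, (if ψ₁ p = 0 then 0 else Real.log p) := by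
    rw [Finset.mul_sum, ← Finset.sum_add_distrib]
    refine Finset.sum_le_sum fun p hp ↦ ?_
    have h := index_term_le (Nat.prime_of_mem_primeFactors hp).two_le (hw p hp) hσ zero_le_one
    simp only [one_mul, mul_one, hw0 p hp] at h
    linarith
  have hlog := sum_log_support_le ψ
  have hK := bigK_pos
  have := mul_le_mul_of_nonneg_left hlog hK.le
  rw [hrel]
  linarith

end EulerComplex

/-! ## Dirichlet series at complex points and the positivity (27) -/

section PositivityComplex

open LSeries ArithmeticFunction DirichletCharacter
open scoped LSeries.notation

variable {k : ℕ} [NeZero k]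

omit [NeZero k] in
/-- `Re(χ(n)Λ(n) n^{−(σ+it)}) = Λ(n) n^{−σ} Re(χ(n) n^{−it})`. [folklore] -/
private theorem re_term_twist_complex (χ : DirichletCharacter ℂ k) (σ t : ℝ) (n : ℕ) :
    (LSeries.term (↗χ * ↗Λ) ((σ : ℂ) + t * I) n).re =
      (Λ n : ℝ) / (n : ℝ) ^ σ * (χ (n : ZMod k) * (n : ℂ) ^ (-(t * I))).re := by
  rcases Nat.eq_zero_or_pos n with rfl | hn
  · simp [LSeries.term_zero]
  have hn0 : (n : ℂ) ≠ 0 := by exact_mod_cast hn.ne'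
  have hpow : (n : ℂ) ^ (σ : ℂ) = (((n : ℝ) ^ σ : ℝ) : ℂ) := by
    rw [Complex.ofReal_cpow (Nat.cast_nonneg n), Complex.ofReal_natCast]
  simp only [LSeries.term_of_ne_zero hn.ne', Pi.mul_apply]
  rw [Complex.cpow_add _ _ hn0, Complex.cpow_neg, hpow,
    show χ (n : ZMod k) * (Λ n : ℂ) / ((((n : ℝ) ^ σ : ℝ) : ℂ) * (n : ℂ) ^ ((t : ℂ) * I)) =
      (((Λ n : ℝ) / (n : ℝ) ^ σ : ℝ) : ℂ) * (χ (n : ZMod k) * ((n : ℂ) ^ ((t : ℂ) * I))⁻¹) by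
      push_cast; ring,
    Complex.re_ofReal_mul]

/-- **`Re(−L'/L(σ + it, χ)) = Σₙ Λ(n) n^{−σ} Re(χ(n) n^{−it})`** for `σ > 1` (the Dirichlet series of
`−L'/L`, real parts). [cite: MontgomeryVaughan2007, (4.25)] -/
theorem hasSum_re_twist_complex (χ : DirichletCharacter ℂ k) {σ : ℝ} (hσ : 1 < σ) (t : ℝ) :
    HasSum (fun n : ℕ ↦ (Λ n : ℝ) / (n : ℝ) ^ σ * (χ (n : ZMod k) * (n : ℂ) ^ (-(t * I))).re)
      ((-(deriv χ.LFunction (σ + t * I) / χ.LFunction (σ + t * I))).re) := by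
  have hs : 1 < ((σ : ℂ) + t * I).re := by simp; exact hσ
  rw [DirichletZFR.neg_logDeriv_LFunction_eq χ hs]
  have hsum : LSeriesSummable (↗χ * ↗Λ) ((σ : ℂ) + t * I) :=
    DirichletCharacter.LSeriesSummable_twist_vonMangoldt χ hs
  have h := Complex.hasSum_re hsum.hasSum
  simp only [re_term_twist_complex] at h
  exact h

omit [NeZero k] in
/-- For a unit `n` mod `k`, `n ≥ 1`: `χᵐ(n) n^{−imt} = (χ(n) n^{−it})ᵐ`. [folklore] -/
private theorem twist_pow_eq (χ : DirichletCharacter ℂ k) (t : ℝ) (n m : ℕ) (u : (ZMod k)ˣ)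
    (hu : (u : ZMod k) = n) :
    (χ ^ m) (n : ZMod k) * (n : ℂ) ^ (-((((m : ℝ) * t : ℝ) : ℂ) * I)) =
      (χ (n : ZMod k) * (n : ℂ) ^ (-(t * I))) ^ m := by
  rw [← hu, MulChar.pow_apply_coe, mul_pow, ← Complex.cpow_nat_mul]
  congr 2
  push_cast
  ring

omit [NeZero k] in
/-- For every `n ≥ 1` and real `t`: `0 ≤ Σₘ aₘ Re(χᵐ(n) n^{−imt})` (`= P(arg(χ(n)n^{−it}))` for `n` a
unit mod `k`, `0` otherwise). [cite: McCurley1984ZFR, §4 (27)] -/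
private theorem rosserSum_twist_nonneg (χ : DirichletCharacter ℂ k) (t : ℝ) {n : ℕ} (hn : 0 < n) :
    0 ≤ rsA0 * ((χ ^ 0) (n : ZMod k) * (n : ℂ) ^ (-(((((0 : ℕ) : ℝ) * t : ℝ) : ℂ) * I))).re
      + rsA1 * ((χ ^ 1) (n : ZMod k) * (n : ℂ) ^ (-(((((1 : ℕ) : ℝ) * t : ℝ) : ℂ) * I))).re
      + rsA2 * ((χ ^ 2) (n : ZMod k) * (n : ℂ) ^ (-(((((2 : ℕ) : ℝ) * t : ℝ) : ℂ) * I))).re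
      + rsA3 * ((χ ^ 3) (n : ZMod k) * (n : ℂ) ^ (-(((((3 : ℕ) : ℝ) * t : ℝ) : ℂ) * I))).re
      + rsA4 * ((χ ^ 4) (n : ZMod k) * (n : ℂ) ^ (-(((((4 : ℕ) : ℝ) * t : ℝ) : ℂ) * I))).re := by
  by_cases ha : IsUnit (n : ZMod k)
  · obtain ⟨u, hu⟩ := ha
    rw [twist_pow_eq χ t n 0 u hu, twist_pow_eq χ t n 1 u hu, twist_pow_eq χ t n 2 u hu,
      twist_pow_eq χ t n 3 u hu, twist_pow_eq χ t n 4 u hu]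
    refine rosserSum_nonneg_of_norm_eq_one ?_
    rw [norm_mul, ← hu, χ.unit_norm_eq_one u, one_mul, Complex.norm_natCast_cpow_of_pos hn]
    simp
  · simp only [MulChar.map_nonunit _ ha, zero_mul, Complex.zero_re, mul_zero, add_zero, le_refl]

/-- **McCurley's (27) at complex points.** For any Dirichlet character `χ` mod `k`, real `σ > 1` and
real `t`: `0 ≤ a₀ f_{χ₀}(σ) + a₁ f(t, χ) + a₂ f(2t, χ²) + a₃ f(3t, χ³) + a₄ f(4t, χ⁴)`
(`f_{χ₀}(σ) = f(0, χ⁰)`): the combined Dirichlet series is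
`Σₙ Λ(n)(n^{−σ} − κn^{−σ₁}) P(arg(χ(n) n^{−it}))` over `(n,k) = 1`, with non-negative terms.
[cite: McCurley1984ZFR, §4 (27)] -/
theorem rosser_positivity_complex (χ : DirichletCharacter ℂ k) {σ : ℝ} (hσ : 1 < σ) (t : ℝ) :
    0 ≤ rsA0 * fdiff (1 : DirichletCharacter ℂ k) σ + rsA1 * fAt χ σ t
      + rsA2 * fAt (χ ^ 2) σ (2 * t) + rsA3 * fAt (χ ^ 3) σ (3 * t) + rsA4 * fAt (χ ^ 4) σ (4 * t) := by
  have hσ₁ : 1 < sigmaOne σ := one_lt_sigmaOne hσ.le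
  have hσσ₁ : σ ≤ sigmaOne σ := (lt_sigmaOne (show (0 : ℝ) < σ by linarith)).le
  have S : ∀ m : ℕ, HasSum (fun n : ℕ ↦
      rsCoeff m * ((Λ n : ℝ) / (n : ℝ) ^ σ *
        ((χ ^ m) (n : ZMod k) * (n : ℂ) ^ (-((((m : ℝ) * t : ℝ) : ℂ) * I))).re)
      - rsCoeff m * (kappa * ((Λ n : ℝ) / (n : ℝ) ^ sigmaOne σ *
        ((χ ^ m) (n : ZMod k) * (n : ℂ) ^ (-((((m : ℝ) * t : ℝ) : ℂ) * I))).re)))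
      (rsCoeff m * fAt (χ ^ m) σ ((m : ℝ) * t)) := by
    intro m
    have h := ((hasSum_re_twist_complex (χ ^ m) hσ ((m : ℝ) * t)).mul_left (rsCoeff m)).sub
      (((hasSum_re_twist_complex (χ ^ m) hσ₁ ((m : ℝ) * t)).mul_left kappa).mul_left (rsCoeff m))
    unfold fAt
    rw [mul_sub]
    exact h
  have hS := (((S 0).add (S 1)).add (S 2)).add ((S 3).add (S 4))
  have e0 : rsCoeff 0 * fAt (χ ^ 0) σ (((0 : ℕ) : ℝ) * t) = rsA0 * fdiff (1 : DirichletCharacter ℂ k) σ := by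
    rw [pow_zero, Nat.cast_zero, zero_mul, fAt_zero]; rfl
  have e1 : rsCoeff 1 * fAt (χ ^ 1) σ (((1 : ℕ) : ℝ) * t) = rsA1 * fAt χ σ t := by
    rw [pow_one, Nat.cast_one, one_mul]; rfl
  have e2 : rsCoeff 2 * fAt (χ ^ 2) σ (((2 : ℕ) : ℝ) * t) = rsA2 * fAt (χ ^ 2) σ (2 * t) := by
    rw [Nat.cast_ofNat]; rfl
  have e3 : rsCoeff 3 * fAt (χ ^ 3) σ (((3 : ℕ) : ℝ) * t) = rsA3 * fAt (χ ^ 3) σ (3 * t) := by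
    rw [Nat.cast_ofNat]; rfl
  have e4 : rsCoeff 4 * fAt (χ ^ 4) σ (((4 : ℕ) : ℝ) * t) = rsA4 * fAt (χ ^ 4) σ (4 * t) := by
    rw [Nat.cast_ofNat]; rfl
  rw [e0, e1, e2, e3, e4] at hS
  have e : rsA0 * fdiff (1 : DirichletCharacter ℂ k) σ + rsA1 * fAt χ σ t
      + rsA2 * fAt (χ ^ 2) σ (2 * t) + rsA3 * fAt (χ ^ 3) σ (3 * t) + rsA4 * fAt (χ ^ 4) σ (4 * t) =
      rsA0 * fdiff (1 : DirichletCharacter ℂ k) σ + rsA1 * fAt χ σ t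
      + rsA2 * fAt (χ ^ 2) σ (2 * t) + (rsA3 * fAt (χ ^ 3) σ (3 * t) + rsA4 * fAt (χ ^ 4) σ (4 * t)) := by
    ring
  rw [e]
  refine hS.nonneg fun n ↦ ?_
  rcases Nat.eq_zero_or_pos n with rfl | hn
  · simp
  simp only [rsCoeff]
  set a := (Λ n : ℝ) with hadef
  set u := (n : ℝ) ^ σ with hudef
  set v := (n : ℝ) ^ sigmaOne σ with hvdef
  have ha : 0 ≤ a := vonMangoldt_nonneg
  have hw : 0 ≤ 1 / u - kappa * (1 / v) := by
    have hn1 : (1 : ℝ) ≤ n := by exact_mod_cast hn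
    have hupos : 0 < u := Real.rpow_pos_of_pos (by linarith) _
    have huv : u ≤ v := Real.rpow_le_rpow_of_exponent_le hn1 hσσ₁
    have h1 : 1 / v ≤ 1 / u := one_div_le_one_div_of_le hupos huv
    have h2 : 0 ≤ 1 / v := by positivity
    nlinarith [kappa_lt_one, kappa_pos]
  have hP := rosserSum_twist_nonneg χ t hn
  set x0 := ((χ ^ 0) (n : ZMod k) * (n : ℂ) ^ (-(((((0 : ℕ) : ℝ) * t : ℝ) : ℂ) * I))).re
  set x1 := ((χ ^ 1) (n : ZMod k) * (n : ℂ) ^ (-(((((1 : ℕ) : ℝ) * t : ℝ) : ℂ) * I))).re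
  set x2 := ((χ ^ 2) (n : ZMod k) * (n : ℂ) ^ (-(((((2 : ℕ) : ℝ) * t : ℝ) : ℂ) * I))).re
  set x3 := ((χ ^ 3) (n : ZMod k) * (n : ℂ) ^ (-(((((3 : ℕ) : ℝ) * t : ℝ) : ℂ) * I))).re
  set x4 := ((χ ^ 4) (n : ZMod k) * (n : ℂ) ^ (-(((((4 : ℕ) : ℝ) * t : ℝ) : ℂ) * I))).re
  have key : 0 ≤ a * (1 / u - kappa * (1 / v)) *
      (rsA0 * x0 + rsA1 * x1 + rsA2 * x2 + rsA3 * x3 + rsA4 * x4) :=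
    mul_nonneg (mul_nonneg ha hw) hP
  have e2 : a * (1 / u - kappa * (1 / v)) * (rsA0 * x0 + rsA1 * x1 + rsA2 * x2 + rsA3 * x3 + rsA4 * x4)
      = (rsA0 * (a / u * x0) - rsA0 * (kappa * (a / v * x0)))
        + (rsA1 * (a / u * x1) - rsA1 * (kappa * (a / v * x1)))
        + (rsA2 * (a / u * x2) - rsA2 * (kappa * (a / v * x2)))
        + ((rsA3 * (a / u * x3) - rsA3 * (kappa * (a / v * x3)))
          + (rsA4 * (a / u * x4) - rsA4 * (kappa * (a / v * x4)))) := by ring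
  linarith [key, e2]

end PositivityComplex

end McCurleyStechkin

end Literature.NumberTheory.LFunctions
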